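import Summits.Ventures.PercRepro0.DualMap
import Summits.Ventures.PercRepro0.EdgeParity

/-!
# The reachable set, the cut and the dual cut of a rectangle (seat p1, gen 1)

First half of the Lean twin of P6-dualcrossing-p1-v1 §3 (Lemma 3.1, «at least one»), OFF the declaration
path (lead 23:00:52Z), in the coordinates of the identification `ψ` of P6 §4 (`dualEdge`, `dualConfig` of
`DualMap.lean`). For a configuration `ω` and the rectangle `B_n = rect n`:

* `reach n ω` = `K`: the vertices of `B_n` joined to the left column by an open walk with all vertices in `B_n`
  (P6 §3); the left column lies in `K`, `K` is closed under open steps inside `B_n`, and the right column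
  misses `K` when `ω ∉ LR_n`;
* `cut n ω` = `𝒦`: the edges of `B_n` with exactly one endpoint in `K`; (i) every cut edge is closed
  (`cut_closed`); (ii) `τ` maps every cut edge to a bond with both endpoints in `B_n` (`dualEdge_cut_mem_rect`:
  the cut has no vertical edge of the columns `0`, `n+1`);
* `dualCut n ω` = `τ(𝒦)` as a finset (the edge set of the graph `H` of P6 §3 (ii), read through `ψ`): its
  edges are open bonds of `dualConfig ω` inside `B_n`;
* the degree formula `edeg_dualCut` (P6 §3 (iii)–(iv)): the degree of `(a, b)` in `τ(𝒦)` is the number of cut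
  edges among the four edges `ab`, `bc`, `dc`, `ad` of the face with corners `A = (b, a−1)`, `B = (b+1, a−1)`,
  `C = (b+1, a)`, `D = (b, a)` (`mem_dualEdge_iff`: `τ⁻¹` of the star of `(a, b)`), and the values of the cut
  indicator `ind` on adjacent pairs inside / outside `B_n`.

The degree parities and the extraction of the crossing are in `DualCrossing.lean`. Imports only landed
PercRepro0 modules (which import Mathlib). No instances, no notation, no axioms.
-/

namespace Summit.Ventures.PercRepro0.DualCut

open Summit.Ventures.PercRepro0.Defs Summit.Ventures.PercRepro0.Crossing
  Summit.Ventures.PercRepro0.DualMap Summit.Ventures.PercRepro0.EdgeParity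
open scoped Classical

/-! ## Coordinates -/

/-- `pt` is injective, iff form. -/
theorem pt_eq_pt {a b c d : ℤ} : pt a b = pt c d ↔ a = c ∧ b = d :=
  ⟨pt_injective2, fun h => by rw [h.1, h.2]⟩

/-- Membership of `pt a b` in the rectangle, in coordinates. -/
theorem pt_mem_rect {n : ℕ} {a b : ℤ} : pt a b ∈ rect n ↔ 0 ≤ a ∧ a ≤ n + 1 ∧ 0 ≤ b ∧ b ≤ n := Iff.rfl

/-- Membership of `pt a b` in the left column, in coordinates. -/
theorem pt_mem_leftCol {n : ℕ} {a b : ℤ} : pt a b ∈ leftCol n ↔ a = 0 ∧ 0 ≤ b ∧ b ≤ n := Iff.rfl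

/-- Membership of `pt a b` in the right column, in coordinates. -/
theorem pt_mem_rightCol {n : ℕ} {a b : ℤ} : pt a b ∈ rightCol n ↔ a = n + 1 ∧ 0 ≤ b ∧ b ≤ n := Iff.rfl

/-- The rectangle is finite (it lies in the box `Λ_{n+1}`). -/
theorem rect_finite (n : ℕ) : (rect n).Finite := by
  refine (box_finite (d := 2) (n + 1)).subset ?_
  rintro x ⟨h0, h1, h2, h3⟩
  refine Fin.forall_fin_two.2 ⟨?_, ?_⟩
  · rw [abs_le]; push_cast; constructor <;> omega
  · rw [abs_le]; push_cast; constructor <;> omega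

/-! ## The reachable set `K` and the cut `𝒦` (P6 §3) -/

/-- `K`: the vertices of `B_n` joined to the left column by an open walk with all vertices in `B_n`. -/
def reach (n : ℕ) (ω : Config 2) : Set (Vertex 2) :=
  {v | v ∈ rect n ∧ ∃ x ∈ leftCol n, ∃ w : (lattice 2).Walk x v,
    (∀ u ∈ w.support, u ∈ rect n) ∧ ∀ e ∈ w.edges, e ∈ ω}

variable {n : ℕ} {ω : Config 2}

/-- `K ⊆ B_n`. -/
theorem reach_subset_rect : reach n ω ⊆ rect n := fun _ h => h.1

/-- The left column lies in `K` (trivial walks). -/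
theorem leftCol_subset_reach {x : Vertex 2} (hx : x ∈ leftCol n) : x ∈ reach n ω :=
  ⟨leftCol_subset_rect n hx, x, hx, SimpleGraph.Walk.nil, fun u hu => by
    rw [SimpleGraph.Walk.support_nil, List.mem_singleton] at hu
    rw [hu]; exact leftCol_subset_rect n hx, fun e he => by simp at he⟩

/-- `K` is closed under open steps inside `B_n`. -/
theorem reach_step {u v : Vertex 2} (hu : u ∈ reach n ω) (hv : v ∈ rect n)
    (hadj : (lattice 2).Adj u v) (he : s(u, v) ∈ ω) : v ∈ reach n ω := by
  obtain ⟨-, x, hx, w, hw, hopen⟩ := hu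
  refine ⟨hv, x, hx, w.concat hadj, ?_, ?_⟩
  · intro z hz
    rw [SimpleGraph.Walk.support_concat, List.mem_append, List.mem_singleton] at hz
    rcases hz with hz | rfl
    · exact hw z hz
    · exact hv
  · intro e he'
    rw [SimpleGraph.Walk.edges_concat, List.concat_eq_append, List.mem_append, List.mem_singleton] at he'
    rcases he' with he' | rfl
    · exact hopen e he'
    · exact he

/-- If `ω ∉ LR_n`, no vertex of the right column lies in `K`. -/
theorem rightCol_notMem_reach (hLR : ω ∉ LR n) {y : Vertex 2} (hy : y ∈ rightCol n) :
    y ∉ reach n ω := by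
  rintro ⟨-, x, hx, w, hw, hopen⟩
  exact hLR ((mem_LR_iff n ω).2 ⟨x, hx, y, hy, w, hw, hopen⟩)

/-- `𝒦`: the edges of `B_n` with exactly one endpoint in `K`. -/
def cut (n : ℕ) (ω : Config 2) : Set (Sym2 (Vertex 2)) :=
  {e | ∃ u v, e = s(u, v) ∧ (lattice 2).Adj u v ∧ u ∈ rect n ∧ v ∈ rect n ∧
    u ∈ reach n ω ∧ v ∉ reach n ω}

/-- Membership in the cut, for a pair. -/
theorem mem_cut_iff (a b : Vertex 2) :
    s(a, b) ∈ cut n ω ↔ (lattice 2).Adj a b ∧ a ∈ rect n ∧ b ∈ rect n ∧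
      Xor (a ∈ reach n ω) (b ∈ reach n ω) := by
  constructor
  · rintro ⟨u, v, he, hadj, hu, hv, huK, hvK⟩
    rcases Sym2.eq_iff.1 he with ⟨rfl, rfl⟩ | ⟨rfl, rfl⟩
    · exact ⟨hadj, hu, hv, Or.inl ⟨huK, hvK⟩⟩
    · exact ⟨hadj.symm, hv, hu, Or.inr ⟨huK, hvK⟩⟩
  · rintro ⟨hadj, ha, hb, ⟨haK, hbK⟩ | ⟨hbK, haK⟩⟩
    · exact ⟨a, b, rfl, hadj, ha, hb, haK, hbK⟩
    · exact ⟨b, a, Sym2.eq_swap, hadj.symm, hb, ha, hbK, haK⟩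

/-- (i) Every cut edge is closed. -/
theorem cut_closed {e : Sym2 (Vertex 2)} (he : e ∈ cut n ω) : e ∉ ω := by
  obtain ⟨u, v, rfl, hadj, _, hv, huK, hvK⟩ := he
  intro hopen
  exact hvK (reach_step huK hv hadj hopen)

/-- Cut edges are bonds. -/
theorem cut_subset_bonds {e : Sym2 (Vertex 2)} (he : e ∈ cut n ω) : e ∈ bonds 2 := by
  obtain ⟨u, v, rfl, hadj, -⟩ := he
  exact hadj

/-- The cut is finite (its edges have both endpoints in `B_n`). -/
theorem cut_finite (n : ℕ) (ω : Config 2) : (cut n ω).Finite := by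
  refine (((rect_finite n).prod (rect_finite n)).image fun p : Vertex 2 × Vertex 2 => s(p.1, p.2)).subset ?_
  rintro e ⟨u, v, rfl, -, hu, hv, -⟩
  exact ⟨(u, v), ⟨hu, hv⟩, rfl⟩

/-- (ii) `τ` maps every cut edge to a bond with both endpoints in `B_n` (when `ω ∉ LR_n`): the cut contains no
vertical edge of the columns `0` and `n+1`, whose `τ`-images would leave the rectangle. -/
theorem dualEdge_cut_mem_rect (hLR : ω ∉ LR n) {e : Sym2 (Vertex 2)} (he : e ∈ cut n ω) :
    ∀ v ∈ dualEdge e, v ∈ rect n := by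
  obtain ⟨i, j, h | h⟩ := bond_cases e (cut_subset_bonds he)
  · rw [h] at he ⊢
    rw [mem_cut_iff, pt_mem_rect, pt_mem_rect] at he
    obtain ⟨-, h1, h2, -⟩ := he
    rw [dualEdge_h]
    intro v hv
    rw [Sym2.mem_iff] at hv
    rcases hv with rfl | rfl <;> rw [pt_mem_rect] <;> omega
  · rw [h] at he ⊢
    rw [mem_cut_iff, pt_mem_rect, pt_mem_rect] at he
    obtain ⟨-, h1, h2, hx⟩ := he
    rw [dualEdge_v]
    have hi0 : i ≠ 0 := by
      rintro rfl
      have ha : pt 0 j ∈ reach n ω := leftCol_subset_reach (pt_mem_leftCol.2 ⟨rfl, by omega, by omega⟩)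
      have hb : pt 0 (j + 1) ∈ reach n ω :=
        leftCol_subset_reach (pt_mem_leftCol.2 ⟨rfl, by omega, by omega⟩)
      rcases hx with ⟨-, h⟩ | ⟨-, h⟩ <;> exact h (by assumption)
    have hin : i ≠ n + 1 := by
      rintro rfl
      have ha : pt (n + 1) j ∉ reach n ω :=
        rightCol_notMem_reach hLR (pt_mem_rightCol.2 ⟨rfl, by omega, by omega⟩)
      have hb : pt (n + 1) (j + 1) ∉ reach n ω :=
        rightCol_notMem_reach hLR (pt_mem_rightCol.2 ⟨rfl, by omega, by omega⟩)
      rcases hx with ⟨h, -⟩ | ⟨h, -⟩ <;> exact (by assumption : _ ∉ reach n ω) h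
    intro v hv
    rw [Sym2.mem_iff] at hv
    rcases hv with rfl | rfl <;> rw [pt_mem_rect] <;> omega

/-! ## The dual cut and its degrees (P6 §3 (iii)–(v)) -/

/-- The cut as a finset. -/
noncomputable def cutF (n : ℕ) (ω : Config 2) : Finset (Sym2 (Vertex 2)) := (cut_finite n ω).toFinset

/-- Membership in `cutF`. -/
theorem mem_cutF {e : Sym2 (Vertex 2)} : e ∈ cutF n ω ↔ e ∈ cut n ω := Set.Finite.mem_toFinset _

/-- The dual cut `τ(𝒦)` as a finset (the edge set of the graph `H` of P6 §3, read through `ψ`). -/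
noncomputable def dualCut (n : ℕ) (ω : Config 2) : Finset (Sym2 (Vertex 2)) := (cutF n ω).image dualEdge

/-- Membership in the dual cut. -/
theorem mem_dualCut {e : Sym2 (Vertex 2)} : e ∈ dualCut n ω ↔ dualEdge e ∈ cut n ω := by
  rw [dualCut, Finset.mem_image]
  constructor
  · rintro ⟨e', he', rfl⟩
    rw [dualEdge_dualEdge]
    exact mem_cutF.1 he'
  · intro h
    exact ⟨dualEdge e, mem_cutF.2 h, dualEdge_dualEdge e⟩

/-- Dual cut edges are bonds. -/
theorem dualCut_subset_bonds {e : Sym2 (Vertex 2)} (he : e ∈ dualCut n ω) : e ∈ bonds 2 := by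
  rw [mem_dualCut] at he
  rw [← dualEdge_mem_bonds]
  exact cut_subset_bonds he

/-- Dual cut edges are open in the dual configuration (by (i)). -/
theorem dualCut_subset_dualConfig {e : Sym2 (Vertex 2)} (he : e ∈ dualCut n ω) : e ∈ dualConfig ω := by
  rw [mem_dualConfig_iff_of_mem ω (dualCut_subset_bonds he)]
  rw [mem_dualCut] at he
  exact cut_closed he

/-- Dual cut edges have both endpoints in `B_n` (by (ii)). -/
theorem dualCut_mem_rect (hLR : ω ∉ LR n) {e : Sym2 (Vertex 2)} (he : e ∈ dualCut n ω) :
    ∀ v ∈ e, v ∈ rect n := by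
  rw [mem_dualCut] at he
  have h := dualEdge_cut_mem_rect hLR he
  rw [dualEdge_dualEdge] at h
  exact h

/-- The four edges of the face `τ⁻¹(star (a, b))`: `ab`, `bc`, `dc`, `ad` for the corners
`A = (b, a−1)`, `B = (b+1, a−1)`, `C = (b+1, a)`, `D = (b, a)` (P6 §3 (iii) through `ψ`). A bond `e` contains
`(a, b)` in its `τ`-image iff `e` is one of them. -/
theorem mem_dualEdge_iff {e : Sym2 (Vertex 2)} (he : e ∈ bonds 2) (a b : ℤ) :
    pt a b ∈ dualEdge e ↔
      e = s(pt b (a - 1), pt (b + 1) (a - 1)) ∨ e = s(pt (b + 1) (a - 1), pt (b + 1) a) ∨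
      e = s(pt b a, pt (b + 1) a) ∨ e = s(pt b (a - 1), pt b a) := by
  obtain ⟨i, j, rfl | rfl⟩ := bond_cases e he
  · rw [dualEdge_h, Sym2.mem_iff, pt_eq_pt, pt_eq_pt]
    constructor
    · rintro (⟨rfl, rfl⟩ | ⟨rfl, rfl⟩)
      · exact Or.inr (Or.inr (Or.inl rfl))
      · left
        rw [add_sub_cancel_right]
    · rintro (h | h | h | h) <;> simp only [Sym2.eq_iff, pt_eq_pt] at h <;> omega
  · rw [dualEdge_v, Sym2.mem_iff, pt_eq_pt, pt_eq_pt]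
    constructor
    · rintro (⟨rfl, rfl⟩ | ⟨rfl, rfl⟩)
      · right; left
        rw [sub_add_cancel, add_sub_cancel_right]
      · right; right; right
        rw [add_sub_cancel_right]
    · rintro (h | h | h | h) <;> simp only [Sym2.eq_iff, pt_eq_pt] at h <;> omega

/-- The indicator of a cut edge. -/
noncomputable def ind (n : ℕ) (ω : Config 2) (e : Sym2 (Vertex 2)) : ℕ := if e ∈ cut n ω then 1 else 0

/-- **The degree formula** (P6 §3 (iii)–(iv)): the degree of `(a, b)` in the dual cut is the number of cut
edges among the four face edges `ab`, `bc`, `dc`, `ad`. -/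
theorem edeg_dualCut (a b : ℤ) :
    edeg (dualCut n ω) (pt a b) =
      ind n ω s(pt b (a - 1), pt (b + 1) (a - 1)) + ind n ω s(pt (b + 1) (a - 1), pt (b + 1) a) +
      ind n ω s(pt b a, pt (b + 1) a) + ind n ω s(pt b (a - 1), pt b a) := by
  have hinj : Function.Injective dualEdge := Function.Involutive.injective dualEdge_dualEdge
  have h1 : edeg (dualCut n ω) (pt a b) = ((cutF n ω).filter fun e => pt a b ∈ dualEdge e).card := by
    rw [edeg, dualCut, Finset.filter_image, Finset.card_image_of_injective _ hinj]
  have h2 : (cutF n ω).filter (fun e => pt a b ∈ dualEdge e) =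
      ({s(pt b (a - 1), pt (b + 1) (a - 1)), s(pt (b + 1) (a - 1), pt (b + 1) a),
        s(pt b a, pt (b + 1) a), s(pt b (a - 1), pt b a)} : Finset (Sym2 (Vertex 2))).filter
        fun e => e ∈ cut n ω := by
    ext e
    simp only [Finset.mem_filter, mem_cutF, Finset.mem_insert, Finset.mem_singleton]
    constructor
    · rintro ⟨he, hv⟩
      exact ⟨(mem_dualEdge_iff (cut_subset_bonds he) a b).1 hv, he⟩
    · rintro ⟨hv, he⟩
      exact ⟨he, (mem_dualEdge_iff (cut_subset_bonds he) a b).2 hv⟩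
  rw [h1, h2, Finset.card_filter]
  have n1 : s(pt b (a - 1), pt (b + 1) (a - 1)) ∉
      ({s(pt (b + 1) (a - 1), pt (b + 1) a), s(pt b a, pt (b + 1) a), s(pt b (a - 1), pt b a)} :
        Finset (Sym2 (Vertex 2))) := by
    simp only [Finset.mem_insert, Finset.mem_singleton, Sym2.eq_iff, pt_eq_pt]
    omega
  have n2 : s(pt (b + 1) (a - 1), pt (b + 1) a) ∉
      ({s(pt b a, pt (b + 1) a), s(pt b (a - 1), pt b a)} : Finset (Sym2 (Vertex 2))) := by
    simp only [Finset.mem_insert, Finset.mem_singleton, Sym2.eq_iff, pt_eq_pt]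
    omega
  have n3 : s(pt b a, pt (b + 1) a) ∉ ({s(pt b (a - 1), pt b a)} : Finset (Sym2 (Vertex 2))) := by
    simp only [Finset.mem_singleton, Sym2.eq_iff, pt_eq_pt]
    omega
  rw [Finset.sum_insert n1, Finset.sum_insert n2, Finset.sum_insert n3, Finset.sum_singleton]
  simp only [ind]
  ring

/-- A cut indicator is the switch indicator of its endpoints, for an adjacent pair inside `B_n`. -/
theorem ind_eq_of_mem {u v : Vertex 2} (hadj : (lattice 2).Adj u v) (hu : u ∈ rect n) (hv : v ∈ rect n) :
    ind n ω s(u, v) = if Xor (u ∈ reach n ω) (v ∈ reach n ω) then 1 else 0 := by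
  unfold ind
  rw [mem_cut_iff]
  simp only [hadj, hu, hv, true_and]

/-- A pair with an endpoint outside `B_n` is not a cut edge. -/
theorem ind_eq_zero_of_notMem {u v : Vertex 2} (h : u ∉ rect n ∨ v ∉ rect n) : ind n ω s(u, v) = 0 := by
  unfold ind
  rw [if_neg]
  rw [mem_cut_iff]
  rintro ⟨-, hu, hv, -⟩
  rcases h with h | h
  · exact h hu
  · exact h hv

/-- A pair whose endpoints are both in `K` (e.g. both in the left column) is not a cut edge. -/
theorem ind_eq_zero_of_both {u v : Vertex 2} (hu : u ∈ reach n ω) (hv : v ∈ reach n ω) :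
    ind n ω s(u, v) = 0 := by
  unfold ind
  rw [if_neg]
  rw [mem_cut_iff]
  rintro ⟨-, -, -, ⟨-, h⟩ | ⟨-, h⟩⟩
  · exact h hv
  · exact h hu

/-- A pair whose endpoints are both outside `K` (e.g. both in the right column) is not a cut edge. -/
theorem ind_eq_zero_of_neither {u v : Vertex 2} (hu : u ∉ reach n ω) (hv : v ∉ reach n ω) :
    ind n ω s(u, v) = 0 := by
  unfold ind
  rw [if_neg]
  rw [mem_cut_iff]
  rintro ⟨-, -, -, ⟨h, -⟩ | ⟨h, -⟩⟩
  · exact hu h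
  · exact hv h

end Summit.Ventures.PercRepro0.DualCut
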